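import Summits.CriticalPhenomena.PercolationContinuityZ3.Theorems.PercNearOneGluingNoHeavyLowerTailLossyPocketPaths
import HarnessLib

/-!
# `NoHeavyLowerTail` (stmt-CriticalPhenomena-4575) — the LOSSY POCKET COVER, core (BHK-free) part:
# `bad ≤ μ({o ↔ A} ∩ {|π(c)| ≤ j}) + Σ_{W,R} Δ(W,R)·μ(P_{W,R})` for ANY fixed relay `c`, given a per-state transfer

Support file (engine seat `prim-cplus-engine` g2; `--supports stmt-CriticalPhenomena-4575`).  No definitions,
no named facts, no sorries; imports only the pocket combinatorics (`…LossyPocketPaths`), hence independent of the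
Kozma–Nitzan/BHK modules.

Notation: `μ = prodBernoulli w` on `Fin n`, relays `A`, observer `o ∉ A`, level `j`, `N = |π(o)|`; pocket data
`(W, R)` = (`o`'s `A`-avoiding pocket, its first contacts), `P_{W,R}` the pocket event (vocabulary of
`Theorems.pocketReduction_sum_pocketEvent`, crux 4576).  Inside `Wᶜ`: `BLK` = "the port block
`⋃_{a∈R} C_{Wᶜ}(a)` has `≤ j` relays", `S_c` = "`C_{Wᶜ}(c)` has `≤ j` relays", `T` = "`c ↔ R` inside `Wᶜ`",
`CSM_c = (T ∩ BLK) ∪ (Tᶜ ∩ S_c)` ("`c` is `j`-small in `G[Wᶜ] + K_R`").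

* `LossyPocketT.determinedBy_inside / _blockSmall / _gluedSmall` — these events are determined by the pairs
  inside `Wᶜ` (so they are independent of `P_{W,R}`, which is determined by the pairs meeting `W`).
* `LossyPocket.term_le_add_of_inside` — per pocket state: if `μ(BLK) ≤ μ(CSM_c) + δ` then
  `μ(P ∩ {1 ≤ N ≤ j}) ≤ μ(P ∩ {o ↔ A} ∩ {|π(c)| ≤ j}) + δ·μ(P)` (pocket Markov property + the combinatorics
  `{1 ≤ N ≤ j} ∩ P = P ∩ BLK`, `{|π(c)| ≤ j} ∩ P = P ∩ CSM_c` of `…LossyPocketPaths`).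
* `LossyPocket.lowerTail_le_add_of_inside` — summed over the partition by pocket data.
* `LossyPocketT.blockSmall_le_gluedSmall_add_rho` — the BLOCK-SLACK discharger (set algebra):
  `μ(BLK) ≤ μ(CSM_c) + (μ(BLK) − μ(S_c))⁺ + ρ_c`, `ρ_c = μ(S_c ∩ T ∩ BLKᶜ)`.
The Kozma–Nitzan single-port discharger (`μ(BLK) ≤ μ(CSM_c) + (Φ_{Wᶜ}(v) − Φ_{Wᶜ}(c))⁺`, BHK) is
`LossyPocketT.blockSmall_le_gluedSmall_add(_inside)` (`…LossyPocketTransfer.lean` ff.); the per-state minimum of the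
two is the slack that survives the compute census (ENGINE-g2.md §5d: single fixed witness ≤ 0.58·(t+δ₀) on the glued
families where the single-port slack alone is off by 10³–10⁷); their naive common refinement (joint slack) is false
(`not_jointGluedTransfer`, `…JointTransferCex.lean`).
-/

noncomputable section

namespace Summit.CriticalPhenomena.PercolationContinuityZ3.Theorems

open MeasureTheory Set Literature.Probability.LatticeModels Literature.Probability.Percolation
open Literature.Probability.Percolation.DCT16 (determinedBy_openConnIn)
open scoped Classical BigOperators

namespace LossyPocketT

variable {n : ℕ}

/-! ### Events read inside `Wᶜ` are determined by the pairs inside `Wᶜ` -/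

section Inside

variable (W : Finset (Fin n))

/-- An event whose membership only depends on the connections inside `Wᶜ` is determined by the pairs inside `Wᶜ`.
[folklore; Grimmett 1999 §2.2] -/
theorem determinedBy_inside (E : Set (BondConfig (Fin n)))
    (hE : ∀ ω ω' : BondConfig (Fin n),
      (∀ a b : Fin n, (ω ∈ openConnIn ((↑W : Set (Fin n))ᶜ) a b ↔ ω' ∈ openConnIn ((↑W : Set (Fin n))ᶜ) a b)) →
        (ω ∈ E ↔ ω' ∈ E)) :
    DeterminedBy E (↑(Finset.univ.filter fun e : Sym2 (Fin n) => ∀ x ∈ e, x ∉ W) : Set (Sym2 (Fin n))) := by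
  have hK : ((↑W : Set (Fin n))ᶜ).sym2 ⊆
      (↑(Finset.univ.filter fun e : Sym2 (Fin n) => ∀ x ∈ e, x ∉ W) : Set (Sym2 (Fin n))) := by
    intro e he
    rw [Finset.coe_filter]
    exact ⟨Finset.mem_univ _, fun x hx => Set.mem_sym2_iff_subset.1 he hx⟩
  rw [determinedBy_iff]
  intro ω ω' h
  exact hE ω ω' fun a b =>
    (determinedBy_iff _ _).1 (determinedBy_openConnIn ((↑W : Set (Fin n))ᶜ) a b hK) ω ω' h

end Inside

/-! ### The events read inside `Wᶜ` are determined by the pairs inside `Wᶜ` -/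

section Det

variable (A W N : Finset (Fin n)) (c : Fin n) (j : ℕ)

/-- The port-block event read inside `Wᶜ` is determined by the pairs inside `Wᶜ`. [folklore] -/
theorem determinedBy_blockSmall :
    DeterminedBy {ω : BondConfig (Fin n) |
        (A.filter fun y => ∃ a ∈ N, ω ∈ openConnIn ((↑W : Set (Fin n))ᶜ) a y).card ≤ j}
      (↑(Finset.univ.filter fun e : Sym2 (Fin n) => ∀ x ∈ e, x ∉ W) : Set (Sym2 (Fin n))) := by
  refine determinedBy_inside W _ fun ω ω' key => ?_
  have : (A.filter fun y => ∃ a ∈ N, ω ∈ openConnIn ((↑W : Set (Fin n))ᶜ) a y) =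
      (A.filter fun y => ∃ a ∈ N, ω' ∈ openConnIn ((↑W : Set (Fin n))ᶜ) a y) :=
    Finset.filter_congr fun y _ => by simp only [key]
  simp only [mem_setOf_eq, this]

/-- The glued-detachment event of `c` read inside `Wᶜ` is determined by the pairs inside `Wᶜ`. [folklore] -/
theorem determinedBy_gluedSmall :
    DeterminedBy {ω : BondConfig (Fin n) |
        ((∃ a ∈ N, ω ∈ openConnIn ((↑W : Set (Fin n))ᶜ) c a) ∧
            (A.filter fun y => ∃ a ∈ N, ω ∈ openConnIn ((↑W : Set (Fin n))ᶜ) a y).card ≤ j) ∨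
          ((¬ ∃ a ∈ N, ω ∈ openConnIn ((↑W : Set (Fin n))ᶜ) c a) ∧
            (A.filter fun y => ω ∈ openConnIn ((↑W : Set (Fin n))ᶜ) c y).card ≤ j)}
      (↑(Finset.univ.filter fun e : Sym2 (Fin n) => ∀ x ∈ e, x ∉ W) : Set (Sym2 (Fin n))) := by
  refine determinedBy_inside W _ fun ω ω' key => ?_
  simp only [mem_setOf_eq, key]

end Det

/-- **Block slack with the ρ-correction (set algebra).**  For any events, writing `T = {c ↔ N inside Wᶜ}`,
`BLK = {port block j-small}`, `S = {c j-small inside Wᶜ}` and `CSM = (T ∩ BLK) ∪ (Tᶜ ∩ S)` ("`c` is `j`-small in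
`G[Wᶜ] + K_N`"):  `μ(BLK) ≤ μ(CSM) + (μ(BLK) − μ(S))⁺ + μ(S ∩ T ∩ BLKᶜ)`.  Indeed
`μ(BLK) − μ(CSM) = μ(BLK ∩ Tᶜ) − μ(S ∩ Tᶜ) = μ(BLK) − μ(S) + μ(S ∩ T) − μ(BLK ∩ T)`.  The last measure,
`ρ_c = μ{c small, c ↔ N, block big}`, is the price of comparing the block with `c` JOINTLY instead of through one
port; the joint comparison WITHOUT `ρ` is false (engine memo §5b, `k = 5` counterexample). [this work] -/
theorem blockSmall_le_gluedSmall_add_rho (w : Sym2 (Fin n) → unitInterval) (A W N : Finset (Fin n))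
    (c : Fin n) (j : ℕ) :
    (prodBernoulli w).real {ω : BondConfig (Fin n) |
        (A.filter fun y => ∃ a ∈ N, ω ∈ openConnIn ((↑W : Set (Fin n))ᶜ) a y).card ≤ j} ≤
      (prodBernoulli w).real {ω : BondConfig (Fin n) |
          ((∃ a ∈ N, ω ∈ openConnIn ((↑W : Set (Fin n))ᶜ) c a) ∧
              (A.filter fun y => ∃ a ∈ N, ω ∈ openConnIn ((↑W : Set (Fin n))ᶜ) a y).card ≤ j) ∨
            ((¬ ∃ a ∈ N, ω ∈ openConnIn ((↑W : Set (Fin n))ᶜ) c a) ∧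
              (A.filter fun y => ω ∈ openConnIn ((↑W : Set (Fin n))ᶜ) c y).card ≤ j)} +
        (max ((prodBernoulli w).real {ω : BondConfig (Fin n) |
              (A.filter fun y => ∃ a ∈ N, ω ∈ openConnIn ((↑W : Set (Fin n))ᶜ) a y).card ≤ j} -
            (prodBernoulli w).real {ω : BondConfig (Fin n) |
              (A.filter fun y => ω ∈ openConnIn ((↑W : Set (Fin n))ᶜ) c y).card ≤ j}) 0 +
          (prodBernoulli w).real ({ω : BondConfig (Fin n) |
              (A.filter fun y => ω ∈ openConnIn ((↑W : Set (Fin n))ᶜ) c y).card ≤ j} ∩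
            {ω | ∃ a ∈ N, ω ∈ openConnIn ((↑W : Set (Fin n))ᶜ) c a} ∩
            {ω : BondConfig (Fin n) |
              (A.filter fun y => ∃ a ∈ N, ω ∈ openConnIn ((↑W : Set (Fin n))ᶜ) a y).card ≤ j}ᶜ)) := by
  set μ := prodBernoulli w with hμ
  set BLK : Set (BondConfig (Fin n)) := {ω |
    (A.filter fun y => ∃ a ∈ N, ω ∈ openConnIn ((↑W : Set (Fin n))ᶜ) a y).card ≤ j} with hBLK
  set T : Set (BondConfig (Fin n)) := {ω | ∃ a ∈ N, ω ∈ openConnIn ((↑W : Set (Fin n))ᶜ) c a} with hT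
  set S : Set (BondConfig (Fin n)) := {ω |
    (A.filter fun y => ω ∈ openConnIn ((↑W : Set (Fin n))ᶜ) c y).card ≤ j} with hS
  set CSM : Set (BondConfig (Fin n)) := {ω |
    ((∃ a ∈ N, ω ∈ openConnIn ((↑W : Set (Fin n))ᶜ) c a) ∧
        (A.filter fun y => ∃ a ∈ N, ω ∈ openConnIn ((↑W : Set (Fin n))ᶜ) a y).card ≤ j) ∨
      ((¬ ∃ a ∈ N, ω ∈ openConnIn ((↑W : Set (Fin n))ᶜ) c a) ∧
        (A.filter fun y => ω ∈ openConnIn ((↑W : Set (Fin n))ᶜ) c y).card ≤ j)} with hCSM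
  have h1 : CSM ∩ T = BLK ∩ T := by
    ext ω
    simp only [hCSM, hBLK, hT, mem_inter_iff, mem_setOf_eq]
    constructor
    · rintro ⟨h | h, ht⟩
      · exact ⟨h.2, ht⟩
      · exact absurd ht h.1
    · rintro ⟨hb, ht⟩
      exact ⟨Or.inl ⟨ht, hb⟩, ht⟩
  have h2 : CSM \ T = S \ T := by
    ext ω
    simp only [hCSM, hS, hT, mem_sdiff, mem_setOf_eq]
    constructor
    · rintro ⟨h | h, ht⟩
      · exact absurd h.1 ht
      · exact ⟨h.2, ht⟩
    · rintro ⟨hs, ht⟩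
      exact ⟨Or.inr ⟨ht, hs⟩, ht⟩
  have e0 : μ.real CSM = μ.real (BLK ∩ T) + μ.real (S \ T) := by
    rw [← measureReal_inter_add_sdiff (s := CSM) (MeasurableSet.of_discrete : MeasurableSet T)
      (measure_ne_top _ _), h1, h2]
  have e1 : μ.real (BLK ∩ T) + μ.real (BLK \ T) = μ.real BLK :=
    measureReal_inter_add_sdiff (MeasurableSet.of_discrete : MeasurableSet T) (measure_ne_top _ _)
  have e2 : μ.real (S ∩ T) + μ.real (S \ T) = μ.real S :=
    measureReal_inter_add_sdiff (MeasurableSet.of_discrete : MeasurableSet T) (measure_ne_top _ _)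
  -- `μ(S ∩ T) ≤ μ(BLK ∩ T) + μ(S ∩ T ∩ BLKᶜ)`
  have e3 : μ.real (S ∩ T) ≤ μ.real (BLK ∩ T) + μ.real (S ∩ T ∩ BLKᶜ) := by
    calc μ.real (S ∩ T) ≤ μ.real ((BLK ∩ T) ∪ (S ∩ T ∩ BLKᶜ)) := measureReal_mono fun ω hω => by
            by_cases hb : ω ∈ BLK
            · exact Or.inl ⟨hb, hω.2⟩
            · exact Or.inr ⟨hω, hb⟩
      _ ≤ μ.real (BLK ∩ T) + μ.real (S ∩ T ∩ BLKᶜ) := measureReal_union_le _ _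
  -- `μ(BLK ∖ T) ≤ μ(BLK)` trivially handles nothing; assemble
  have h4 : μ.real BLK - μ.real S ≤ max (μ.real BLK - μ.real S) 0 := le_max_left _ _
  linarith [measureReal_nonneg (μ := μ) (s := BLK \ T)]

end LossyPocketT

namespace LossyPocket

variable {n : ℕ}

/-- **Per-pocket-state inequality, abstract transfer.**  As `LossyPocket.term_le_add`, but the hypothesis is the
transfer inequality itself, read inside `Wᶜ`: if the data `(W, N)` are realised, `N ≠ ∅` and `c ∉ N`, then
`μ{glued port block j-small inside Wᶜ} ≤ μ{c j-small in G[Wᶜ] + K_N} + δ`.  Conclusion: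
`μ(P_{W,N} ∩ {1 ≤ N_o ≤ j}) ≤ μ(P_{W,N} ∩ {o ↔ A} ∩ {|π(c)| ≤ j}) + δ·μ(P_{W,N})`.  Dischargers of the hypothesis:
`LossyPocketT.blockSmall_le_gluedSmall_add_inside` (Kozma–Nitzan single-port slack) and
`LossyPocketT.blockSmall_le_gluedSmall_add_rho` (block slack + ρ, set algebra); any per-state minimum of the two is
admissible. [this work] -/
theorem term_le_add_of_inside (w : Sym2 (Fin n) → unitInterval) (A : Finset (Fin n)) (o c : Fin n) (j : ℕ)
    (hoA : o ∉ A) (hc : c ∈ A) (W N : Finset (Fin n)) {δ : ℝ} (hδ : 0 ≤ δ)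
    (hyp : ({ω : BondConfig (Fin n) |
          (Finset.univ.filter fun v => ω ∈ openConnIn ((↑A : Set (Fin n))ᶜ) o v) = W ∧
          (A.filter fun a => ω ∈ openConnIn (insert a ((↑A : Set (Fin n))ᶜ)) o a) = N} : Set _).Nonempty →
      N.Nonempty → c ∉ N →
        (prodBernoulli w).real {ω : BondConfig (Fin n) |
            (A.filter fun y => ∃ a ∈ N, ω ∈ openConnIn ((↑W : Set (Fin n))ᶜ) a y).card ≤ j} ≤
          (prodBernoulli w).real {ω : BondConfig (Fin n) |
            ((∃ a ∈ N, ω ∈ openConnIn ((↑W : Set (Fin n))ᶜ) c a) ∧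
                (A.filter fun y => ∃ a ∈ N, ω ∈ openConnIn ((↑W : Set (Fin n))ᶜ) a y).card ≤ j) ∨
              ((¬ ∃ a ∈ N, ω ∈ openConnIn ((↑W : Set (Fin n))ᶜ) c a) ∧
                (A.filter fun y => ω ∈ openConnIn ((↑W : Set (Fin n))ᶜ) c y).card ≤ j)} + δ) :
    (prodBernoulli w).real
        ({ω : BondConfig (Fin n) |
            (Finset.univ.filter fun v => ω ∈ openConnIn ((↑A : Set (Fin n))ᶜ) o v) = W ∧
            (A.filter fun a => ω ∈ openConnIn (insert a ((↑A : Set (Fin n))ᶜ)) o a) = N} ∩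
          {ω : BondConfig (Fin n) | 1 ≤ (A.filter fun x => ω ∈ openConn o x).card ∧
            (A.filter fun x => ω ∈ openConn o x).card ≤ j}) ≤
      (prodBernoulli w).real
          ({ω : BondConfig (Fin n) |
              (Finset.univ.filter fun v => ω ∈ openConnIn ((↑A : Set (Fin n))ᶜ) o v) = W ∧
              (A.filter fun a => ω ∈ openConnIn (insert a ((↑A : Set (Fin n))ᶜ)) o a) = N} ∩
            ((⋃ a' ∈ A, (openConn o a' : Set (BondConfig (Fin n)))) ∩
              {ω : BondConfig (Fin n) | (A.filter fun x => ω ∈ openConn c x).card ≤ j})) +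
        δ * (prodBernoulli w).real
          {ω : BondConfig (Fin n) |
            (Finset.univ.filter fun v => ω ∈ openConnIn ((↑A : Set (Fin n))ᶜ) o v) = W ∧
            (A.filter fun a => ω ∈ openConnIn (insert a ((↑A : Set (Fin n))ᶜ)) o a) = N} := by
  set μ := prodBernoulli w with hμ
  set bad : Set (BondConfig (Fin n)) := {ω | 1 ≤ (A.filter fun x => ω ∈ openConn o x).card ∧
    (A.filter fun x => ω ∈ openConn o x).card ≤ j} with hbad
  set U : Set (BondConfig (Fin n)) := ⋃ a' ∈ A, (openConn o a' : Set (BondConfig (Fin n))) with hU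
  set Sc : Set (BondConfig (Fin n)) := {ω | (A.filter fun x => ω ∈ openConn c x).card ≤ j} with hSc
  set PK : Set (BondConfig (Fin n)) :=
    {ω | (Finset.univ.filter fun v => ω ∈ openConnIn ((↑A : Set (Fin n))ᶜ) o v) = W ∧
      (A.filter fun a => ω ∈ openConnIn (insert a ((↑A : Set (Fin n))ᶜ)) o a) = N} with hPK
  have hΔμ : 0 ≤ δ * μ.real PK := mul_nonneg hδ measureReal_nonneg
  rcases Set.eq_empty_or_nonempty PK with hPe | ⟨ω₀, hω₀⟩
  · rw [hPe, empty_inter, empty_inter, measureReal_empty]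
    linarith
  rcases N.eq_empty_or_nonempty with hNe | hNne
  · rw [show PK ∩ bad = ∅ from lowerTail_inter_pocket_empty A o W N hoA hNe j, measureReal_empty]
    linarith [measureReal_nonneg (μ := μ) (s := PK ∩ (U ∩ Sc))]
  by_cases hcN : c ∈ N
  · have hsub := lowerTail_inter_pocket_subset_of_mem A o W N hcN j
    linarith [measureReal_mono (μ := μ) hsub]
  -- the main case: `N ≠ ∅`, `c ∉ N`, realised data
  set BLK : Set (BondConfig (Fin n)) := {ω |
    (A.filter fun y => ∃ a ∈ N, ω ∈ openConnIn ((↑W : Set (Fin n))ᶜ) a y).card ≤ j} with hBLK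
  set CSM : Set (BondConfig (Fin n)) := {ω |
    ((∃ a ∈ N, ω ∈ openConnIn ((↑W : Set (Fin n))ᶜ) c a) ∧
        (A.filter fun y => ∃ a ∈ N, ω ∈ openConnIn ((↑W : Set (Fin n))ᶜ) a y).card ≤ j) ∨
      ((¬ ∃ a ∈ N, ω ∈ openConnIn ((↑W : Set (Fin n))ᶜ) c a) ∧
        (A.filter fun y => ω ∈ openConnIn ((↑W : Set (Fin n))ᶜ) c y).card ≤ j)} with hCSM
  have hE1 : PK ∩ bad = PK ∩ BLK := lowerTail_inter_pocket A o W N hoA hNne j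
  have hPU : PK ⊆ U := by
    intro ω hω
    obtain ⟨a, ha⟩ := hNne
    exact mem_iUnion₂.2 ⟨a, (contacts_subset A o W N hω ha).1, reachable_of_mem_contacts A o W N hω ha⟩
  have hE2 : PK ∩ (U ∩ Sc) = PK ∩ CSM := by
    rw [← relaySmall_inter_pocket A o W N hoA hc j]
    ext ω
    exact ⟨fun ⟨h1, _, h3⟩ => ⟨h1, h3⟩, fun ⟨h1, h3⟩ => ⟨h1, hPU h1, h3⟩⟩
  -- independence of the pocket event from the events read inside `Wᶜ`
  set F : Finset (Sym2 (Fin n)) := Finset.univ.filter fun e : Sym2 (Fin n) => ∃ x ∈ W, x ∈ e with hF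
  set F' : Finset (Sym2 (Fin n)) := Finset.univ.filter fun e : Sym2 (Fin n) => ∀ x ∈ e, x ∉ W with hF'
  have hdisj : Disjoint F F' := by
    rw [Finset.disjoint_left]
    intro e he he'
    obtain ⟨x, hxW, hxe⟩ := (Finset.mem_filter.1 he).2
    exact (Finset.mem_filter.1 he').2 x hxe hxW
  have hPdet : DeterminedBy PK (↑F : Set (Sym2 (Fin n))) := pocketMarkov_determinedBy_pocketEvent A o W N
  have hfacB : μ.real (PK ∩ BLK) = μ.real PK * μ.real BLK :=
    prodBernoulli_real_inter_of_determinedBy_disjoint w hdisj hPdet (LossyPocketT.determinedBy_blockSmall A W N j)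
      (Set.toFinite _).measurableSet (Set.toFinite _).measurableSet
  have hfacC : μ.real (PK ∩ CSM) = μ.real PK * μ.real CSM :=
    prodBernoulli_real_inter_of_determinedBy_disjoint w hdisj hPdet (LossyPocketT.determinedBy_gluedSmall A W N c j)
      (Set.toFinite _).measurableSet (Set.toFinite _).measurableSet
  -- the glued-block transfer inside `Wᶜ`
  have htr : μ.real BLK ≤ μ.real CSM + δ := hyp ⟨ω₀, hω₀⟩ hNne hcN
  rw [hE1, hE2, hfacB, hfacC]
  have hP0 : 0 ≤ μ.real PK := measureReal_nonneg
  calc μ.real PK * μ.real BLK ≤ μ.real PK * (μ.real CSM + δ) := mul_le_mul_of_nonneg_left htr hP0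
    _ = μ.real PK * μ.real CSM + δ * μ.real PK := by ring

/-- **The lossy pocket cover, abstract transfer** (ENGINE-g2.md §5d).  `o ∉ A`, `c ∈ A` fixed, `Δ(W,R) ≥ 0` with,
for every realised pocket data `(W, R)`, `R ≠ ∅`, `c ∉ R`:
`μ{port block j-small inside Wᶜ} ≤ μ{c j-small in G[Wᶜ] + K_R} + Δ(W,R)`.  Then
`μ{1 ≤ N ≤ j} ≤ μ({o ↔ A} ∩ {|π(c)| ≤ j}) + Σ_{W,R} Δ(W,R)·μ(P_{W,R})`.  With `Δ` the per-state MINIMUM of the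
Kozma–Nitzan single-port slack and the block slack `(μ{block small} − Φ_{Wᶜ}(c))⁺ + ρ_c` this is the bound
`bad ≤ Φ_G(c) + GAP_min(c)` of the memo (numerically the surviving single-witness cover). [this work] -/
theorem lowerTail_le_add_of_inside (w : Sym2 (Fin n) → unitInterval) (A : Finset (Fin n)) (o c : Fin n) (j : ℕ)
    (hoA : o ∉ A) (hc : c ∈ A) (Δ : Finset (Fin n) → Finset (Fin n) → ℝ) (hΔ0 : ∀ W N, 0 ≤ Δ W N)
    (hΔ : ∀ W N : Finset (Fin n),
      ({ω : BondConfig (Fin n) |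
          (Finset.univ.filter fun v => ω ∈ openConnIn ((↑A : Set (Fin n))ᶜ) o v) = W ∧
          (A.filter fun a => ω ∈ openConnIn (insert a ((↑A : Set (Fin n))ᶜ)) o a) = N} : Set _).Nonempty →
      N.Nonempty → c ∉ N →
        (prodBernoulli w).real {ω : BondConfig (Fin n) |
            (A.filter fun y => ∃ a ∈ N, ω ∈ openConnIn ((↑W : Set (Fin n))ᶜ) a y).card ≤ j} ≤
          (prodBernoulli w).real {ω : BondConfig (Fin n) |
            ((∃ a ∈ N, ω ∈ openConnIn ((↑W : Set (Fin n))ᶜ) c a) ∧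
                (A.filter fun y => ∃ a ∈ N, ω ∈ openConnIn ((↑W : Set (Fin n))ᶜ) a y).card ≤ j) ∨
              ((¬ ∃ a ∈ N, ω ∈ openConnIn ((↑W : Set (Fin n))ᶜ) c a) ∧
                (A.filter fun y => ω ∈ openConnIn ((↑W : Set (Fin n))ᶜ) c y).card ≤ j)} + Δ W N) :
    (prodBernoulli w).real {ω : BondConfig (Fin n) |
        1 ≤ (A.filter fun x => ω ∈ openConn o x).card ∧ (A.filter fun x => ω ∈ openConn o x).card ≤ j} ≤
      (prodBernoulli w).real ((⋃ a' ∈ A, (openConn o a' : Set (BondConfig (Fin n)))) ∩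
          {ω : BondConfig (Fin n) | (A.filter fun x => ω ∈ openConn c x).card ≤ j}) +
        ∑ W : Finset (Fin n), ∑ N : Finset (Fin n), Δ W N *
          (prodBernoulli w).real {ω : BondConfig (Fin n) |
            (Finset.univ.filter fun v => ω ∈ openConnIn ((↑A : Set (Fin n))ᶜ) o v) = W ∧
            (A.filter fun a => ω ∈ openConnIn (insert a ((↑A : Set (Fin n))ᶜ)) o a) = N} := by
  set μ := prodBernoulli w with hμ
  set bad : Set (BondConfig (Fin n)) := {ω | 1 ≤ (A.filter fun x => ω ∈ openConn o x).card ∧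
    (A.filter fun x => ω ∈ openConn o x).card ≤ j} with hbad
  set U : Set (BondConfig (Fin n)) := ⋃ a' ∈ A, (openConn o a' : Set (BondConfig (Fin n))) with hU
  set Sc : Set (BondConfig (Fin n)) := {ω | (A.filter fun x => ω ∈ openConn c x).card ≤ j} with hSc
  set PK : Finset (Fin n) → Finset (Fin n) → Set (BondConfig (Fin n)) := fun W N =>
    {ω | (Finset.univ.filter fun v => ω ∈ openConnIn ((↑A : Set (Fin n))ᶜ) o v) = W ∧
      (A.filter fun a => ω ∈ openConnIn (insert a ((↑A : Set (Fin n))ᶜ)) o a) = N} with hPK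
  have key : ∀ W N : Finset (Fin n),
      μ.real (PK W N ∩ bad) ≤ μ.real (PK W N ∩ (U ∩ Sc)) + Δ W N * μ.real (PK W N) :=
    fun W N => term_le_add_of_inside w A o c j hoA hc W N (hΔ0 W N) (hΔ W N)
  rw [pocketReduction_sum_pocketEvent w A o bad, pocketReduction_sum_pocketEvent w A o (U ∩ Sc)]
  calc ∑ W : Finset (Fin n), ∑ N : Finset (Fin n), μ.real (PK W N ∩ bad)
      ≤ ∑ W : Finset (Fin n), ∑ N : Finset (Fin n),
          (μ.real (PK W N ∩ (U ∩ Sc)) + Δ W N * μ.real (PK W N)) :=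
        Finset.sum_le_sum fun W _ => Finset.sum_le_sum fun N _ => key W N
    _ = (∑ W : Finset (Fin n), ∑ N : Finset (Fin n), μ.real (PK W N ∩ (U ∩ Sc))) +
          ∑ W : Finset (Fin n), ∑ N : Finset (Fin n), Δ W N * μ.real (PK W N) := by
        simp only [Finset.sum_add_distrib]

end LossyPocket

end Summit.CriticalPhenomena.PercolationContinuityZ3.Theorems

end
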